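import Summits.KontsevichZagierPeriods.KontsevichZagierPeriods.Theorems.OctahedralSymmetryOctahedralSpanAllWeightsDefs
import Mathlib.LinearAlgebra.Finsupp.LSum
import Mathlib.LinearAlgebra.Span.Basic
import HarnessLib

/-!
# Crux `OctahedralSpanAllWeights` (stmt-KontsevichZagierPeriods-9659), line `Sketch`:
# tools for the σ-inclusion–exclusion (block F2) — multilinearity of letter expansions, templates

Helper file 1/2 for the all-weights theorem `unit_manyTwos` of block F2 (file
`…StubRegularUnitManyTwos`): a unit word with a majority of letters `2` reduces modulo `rel` to unit
words with fewer letters `2`, by an inclusion–exclusion of involution generators.  This file holds the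
position-free bookkeeping that theorem needs:

* §1 `expandZ φ` — a letter table `φ : Fin 5 → List (ℤ × Fin 5)` acting additively on formal
  `ℤ`-combinations of words (`[V] ↦ ofTerms (expand φ V)`); the recursion `ofTerms_expand_cons`;
  **multilinearity** `expandZ_ofTerms_expand` (registered helper stub): expanding under `lam` and then
  under `κ` is expanding under the composite table `compT lam κ`; `toQ_mapDomain`, `ofTerms_map_reverse`.
* §2 templates: `mark m W` replaces the first `m` letters `2` of `W` by the MARKER letter `0` (unit words
  have no `0`), `unmark` erases markers; `unmark_mark`, `length_mark`, `count_zero_mark`, `mem_mark`.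

Sources: J. Zhao, C. R. Acad. Sci. Paris 346 (2008), §4 (letter tables of the octahedral involution)
[Zhao2008]; the rest is folklore multilinear algebra on words.
-/

noncomputable section

namespace Summit.KontsevichZagierPeriods.OctahedralSymmetry.OctaSpan.ManyTwos

open Literature.NumberTheory.Transcendental Literature.NumberTheory.Transcendental.LevelFour

/-! ## 1. Letter tables acting on formal combinations; multilinearity -/

/-- A letter table `φ` acting on formal `ℤ`-combinations of words: `[V] ↦ ofTerms (expand φ V)`,
extended additively. [folklore] -/
def expandZ (φ : Fin 5 → List (ℤ × Fin 5)) : (List (Fin 5) →₀ ℤ) →+ (List (Fin 5) →₀ ℤ) :=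
  Finsupp.liftAddHom fun V => zmultiplesHom _ (ofTerms (expand φ V))

/-- `expandZ φ (c • [V]) = c • ofTerms (expand φ V)`. [folklore] -/
@[simp] theorem expandZ_single (φ : Fin 5 → List (ℤ × Fin 5)) (V : List (Fin 5)) (c : ℤ) :
    expandZ φ (Finsupp.single V c) = c • ofTerms (expand φ V) := by
  simp [expandZ]

/-- Prepending a fixed letter to every word of a term list and scaling: on `ofTerms` this is
`c • mapDomain (b :: ·)`. [folklore] -/
theorem ofTerms_map_cons (c : ℤ) (b : Fin 5) (L : List (ℤ × List (Fin 5))) :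
    ofTerms (L.map fun dV => (c * dV.1, b :: dV.2)) = c • (ofTerms L).mapDomain (List.cons b) := by
  induction L with
  | nil => simp
  | cons t L ih =>
    rw [List.map_cons, ofTerms_cons, ofTerms_cons, ih, Finsupp.mapDomain_add, smul_add,
      Finsupp.mapDomain_single, Finsupp.smul_single, smul_eq_mul]

/-- The recursion of `ofTerms ∘ expand`: `ofTerms (expand φ (a :: W)) =
Σ_{(c, b) ∈ φ a} c • (b :: ·)_* ofTerms (expand φ W)`. [folklore] -/
theorem ofTerms_expand_cons (φ : Fin 5 → List (ℤ × Fin 5)) (a : Fin 5) (W : List (Fin 5)) :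
    ofTerms (expand φ (a :: W)) =
      ((φ a).map fun cb => cb.1 • (ofTerms (expand φ W)).mapDomain (List.cons cb.2)).sum := by
  rw [expand_cons]
  induction φ a with
  | nil => simp
  | cons cb L ih => rw [List.flatMap_cons, ofTerms_append, ih, ofTerms_map_cons, List.map_cons,
      List.sum_cons]

/-- `expandZ φ` after prepending the letter `b`: expand `b` by the table and prepend its letters.
[folklore] -/
theorem expandZ_mapDomain_cons (φ : Fin 5 → List (ℤ × Fin 5)) (b : Fin 5) (x : List (Fin 5) →₀ ℤ) :
    expandZ φ (x.mapDomain (List.cons b)) =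
      ((φ b).map fun de => de.1 • (expandZ φ x).mapDomain (List.cons de.2)).sum := by
  induction x using Finsupp.induction with
  | zero => simp
  | single_add V c f _ _ ih =>
    rw [Finsupp.mapDomain_add, map_add, map_add, ih, Finsupp.mapDomain_single, expandZ_single,
      expandZ_single, ofTerms_expand_cons, List.smul_sum, List.map_map, ← List.sum_map_add]
    congr 1
    refine List.map_congr_left fun de _ => ?_
    simp only [Function.comp_apply, Finsupp.mapDomain_add, smul_add, Finsupp.mapDomain_smul]
    rw [smul_comm]

/-- The COMPOSITE of two letter tables: first `lam`, then `κ` on every produced letter. [folklore] -/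
def compT (lam κ : Fin 5 → List (ℤ × Fin 5)) : Fin 5 → List (ℤ × Fin 5) :=
  fun a => (lam a).flatMap fun cb => (κ cb.2).map fun de => (cb.1 * de.1, de.2)

/-- **Multilinearity of expansions.** Expanding a word under `lam` and then every resulting word
under `κ` is the expansion under the composite table. [folklore] -/
theorem expandZ_ofTerms_expand (lam κ : Fin 5 → List (ℤ × Fin 5)) :
    ∀ W : List (Fin 5), expandZ κ (ofTerms (expand lam W)) = ofTerms (expand (compT lam κ) W)
  | [] => by simp [ofTerms]
  | a :: W => by
    -- the sum over a `flatMap` is the sum of the sums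
    have hsf : ∀ (l : List (ℤ × Fin 5)) (f : ℤ × Fin 5 → List (List (Fin 5) →₀ ℤ)),
        (l.flatMap f).sum = (l.map fun x => (f x).sum).sum := by
      intro l f
      induction l with
      | nil => simp
      | cons x l ih => rw [List.flatMap_cons, List.sum_append, List.map_cons, List.sum_cons, ih]
    rw [ofTerms_expand_cons, ofTerms_expand_cons, map_list_sum, List.map_map]
    simp only [Function.comp_def, map_zsmul, expandZ_mapDomain_cons, expandZ_ofTerms_expand lam κ W,
      List.smul_sum, List.map_map]
    rw [show (compT lam κ a) = (lam a).flatMap fun cb => (κ cb.2).map fun de => (cb.1 * de.1, de.2)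
      from rfl, List.map_flatMap, hsf]
    congr 1
    refine List.map_congr_left fun cb _ => ?_
    simp only [Function.comp_def, List.map_map, mul_smul]

/-- `toQ` commutes with relabelling the words. [folklore] -/
theorem toQ_mapDomain (f : List (Fin 5) → List (Fin 5)) (x : List (Fin 5) →₀ ℤ) :
    toQ (x.mapDomain f) = Finsupp.lmapDomain ℚ ℚ f (toQ x) := by
  induction x using Finsupp.induction with
  | zero => simp
  | single_add W c g _ _ ih =>
    rw [Finsupp.mapDomain_add, map_add, map_add, map_add, ih, Finsupp.mapDomain_single, toQ_single,
      toQ_single, map_zsmul]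
    simp only [sym, Finsupp.lmapDomain_apply, Finsupp.mapDomain_single]

/-- `ofTerms` of a term list with reversed words is the reversal of `ofTerms`. [folklore] -/
theorem ofTerms_map_reverse (L : List (ℤ × List (Fin 5))) :
    ofTerms (L.map fun p => (p.1, p.2.reverse)) = (ofTerms L).mapDomain List.reverse := by
  induction L with
  | nil => simp
  | cons p L ih => rw [List.map_cons, ofTerms_cons, ofTerms_cons, Finsupp.mapDomain_add,
      Finsupp.mapDomain_single, ih]

/-! ## 2. Templates: marking letters `2` -/

/-- `mark m W`: the word `W` with its first `m` letters `2` replaced by the MARKER letter `0`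
(unit words contain no `0`, so the marker is unambiguous). [folklore] -/
def mark : ℕ → List (Fin 5) → List (Fin 5)
  | 0, W => W
  | _ + 1, [] => []
  | m + 1, a :: W => if a = 2 then 0 :: mark m W else a :: mark (m + 1) W

/-- `mark 0 W = W`. [folklore] -/
@[simp] theorem mark_zero (W : List (Fin 5)) : mark 0 W = W := by cases W <;> rfl

/-- Erasing the markers: `0 ↦ 2`. [folklore] -/
def unmark (T : List (Fin 5)) : List (Fin 5) := T.map fun a => if a = 0 then 2 else a

/-- `unmark` on a cons. [folklore] -/
@[simp] theorem unmark_cons (a : Fin 5) (T : List (Fin 5)) :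
    unmark (a :: T) = (if a = 0 then 2 else a) :: unmark T := rfl

/-- `unmark [] = []`. [folklore] -/
@[simp] theorem unmark_nil : unmark [] = [] := rfl

/-- `unmark` preserves the length. [folklore] -/
@[simp] theorem length_unmark (T : List (Fin 5)) : (unmark T).length = T.length := by simp [unmark]

/-- A word without markers is its own `unmark`. [folklore] -/
theorem unmark_of_not_mem {W : List (Fin 5)} (h : (0 : Fin 5) ∉ W) : unmark W = W := by
  induction W with
  | nil => rfl
  | cons a W ih =>
    rw [unmark_cons, if_neg (fun ha => h (by simp [ha])), ih (fun h' => h (List.mem_cons_of_mem a h'))]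

/-- Erasing the markers of `mark m W` gives back `W` (if `W` has no letter `0`). [folklore] -/
theorem unmark_mark : ∀ (m : ℕ) (W : List (Fin 5)), (0 : Fin 5) ∉ W → unmark (mark m W) = W
  | 0, W, h => by rw [mark_zero]; exact unmark_of_not_mem h
  | _ + 1, [], _ => rfl
  | m + 1, a :: W, h => by
    have hW : (0 : Fin 5) ∉ W := fun h' => h (List.mem_cons_of_mem a h')
    have ha : a ≠ 0 := fun ha => h (by simp [ha])
    rw [mark]
    split_ifs with h2
    · rw [unmark_cons, if_pos rfl, unmark_mark m W hW, h2]
    · rw [unmark_cons, if_neg ha, unmark_mark (m + 1) W hW]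

/-- `mark` preserves the length. [folklore] -/
theorem length_mark : ∀ (m : ℕ) (W : List (Fin 5)), (mark m W).length = W.length
  | 0, W => by rw [mark_zero]
  | _ + 1, [] => rfl
  | m + 1, a :: W => by
    rw [mark]
    split_ifs
    · rw [List.length_cons, length_mark m W, List.length_cons]
    · rw [List.length_cons, length_mark (m + 1) W, List.length_cons]

/-- `mark m W` carries exactly `m` markers when `W` has at least `m` letters `2` (and no `0`).
[folklore] -/
theorem count_zero_mark : ∀ (m : ℕ) (W : List (Fin 5)), (0 : Fin 5) ∉ W → m ≤ W.count 2 →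
    (mark m W).count 0 = m
  | 0, W, h, _ => by rw [mark_zero]; exact List.count_eq_zero.2 h
  | m + 1, [], _, hm => by simp at hm
  | m + 1, a :: W, h, hm => by
    have hW : (0 : Fin 5) ∉ W := fun h' => h (List.mem_cons_of_mem a h')
    have ha : a ≠ 0 := fun ha => h (by simp [ha])
    rw [mark]
    split_ifs with h2
    · subst h2
      rw [List.count_cons_self] at hm
      rw [List.count_cons_self, count_zero_mark m W hW (by omega)]
    · rw [List.count_cons_of_ne h2] at hm
      rw [List.count_cons_of_ne ha, count_zero_mark (m + 1) W hW hm]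

/-- The letters of `mark m W` are markers or letters of `W`. [folklore] -/
theorem mem_mark : ∀ (m : ℕ) (W : List (Fin 5)) (b : Fin 5), b ∈ mark m W → b = 0 ∨ b ∈ W
  | 0, W, _, h => Or.inr (by rwa [mark_zero] at h)
  | _ + 1, [], _, h => by simp [mark] at h
  | m + 1, a :: W, b, h => by
    rw [mark] at h
    split_ifs at h with h2
    · rcases List.mem_cons.1 h with rfl | h
      · exact Or.inl rfl
      · exact (mem_mark m W b h).imp id (List.mem_cons_of_mem a)
    · rcases List.mem_cons.1 h with rfl | h
      · exact Or.inr (by simp)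
      · exact (mem_mark (m + 1) W b h).imp id (List.mem_cons_of_mem a)

end Summit.KontsevichZagierPeriods.OctahedralSymmetry.OctaSpan.ManyTwos

end
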